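import Summits.BirchSwinnertonDyer.BirchSwinnertonDyer.Theorems.GenusKolyvaginAtTwoMinimalTwinBSDTwoConverseSupplies
import Summits.BirchSwinnertonDyer.BirchSwinnertonDyer.Theses.ByReductionTypeAtTwo
import HarnessLib

/-!
# Route `GenusKolyvaginAtTwo` (rev 59), crux U₂ `MinimalTwinBSDTwo` (stmt-BirchSwinnertonDyer-22985): THE CONVERSE LEDGER —
# U₂|`closes` ⟸ WALL + CONV₀ (route `TwoAdicConverse`'s items stmt-19218 + stmt-19219 BY NAME + the off-semistable rank-zero 2-converse)
# + EXP⁺ + EXP⁻ + `S_id` + PRINT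

Seat `bsd-line-gk2-p3` g30 (PROVER seat 3/3, cell `bsd-f1-sign2`), `--supports stmt-BirchSwinnertonDyer-22985` (helper; closes nothing).
THEOREMS ONLY (§1 one ledger; §2 appended: the walls BY NAME + the leaf form), no definition, no named fact, no `sorry`; standard axioms.  **BSD is NOT proved by this file; U₂, the wall, the 2-converse items,
EXP and `S_id` are NOT proved; no item is closed.**  Companion of `…MinimalTwinBSDTwoConverseSupplies` (this seat, same gen), which derives
p773745's two L-VALUE supplies NV⁺ / NV⁻ VERBATIM from a rank-zero `2`-converse on non-CM curves
(`nonvanishingSilent/Door_of_rankZeroTwoConverse_of_facts`) and assembles that converse from route `TwoAdicConverse`'s items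
`GoodOrdinaryRankZeroTwoConverse` (stmt-19218), `MultiplicativeRankZeroTwoConverse` (stmt-19219) and a converse off the semistable-ordinary
locus at `2` (`rankZeroTwoConverse_of_items_of_offSemistable`).  Plugged into p773745's NV/EXP ledger
`nonCMAtTwo_of_items_of_slicedWall_of_nonvanishing_of_exponent_of_idLocus_line25`, this gives the ledger below: inside the consumed cells U₂ has
NO independent L-value input left — its analytic supply IS the sibling route's rank-zero `2`-converse; what remains beyond the two routes' items
is the two-cell rank-zero WALL, the two EXPONENT statements EXP± (the 2-adic exponent of `y_K`; lossless, = `BSD₂` on the cell modulo the rest),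
`S_id` (stmt-32821) and PRINT.  §2 (appended) takes the two sliced walls BY NAME from route `ByReductionTypeAtTwo`'s WALL row 1 (stmt-19095
`GoodOrdinaryRankZeroAtTwo`, 19096 `MultiplicativeRankZeroAtTwo`, 19097 `SupersingularRankZeroAtTwo`, 19098 `AdditiveRankZeroAtTwo`), notes that rung
S3's leaf `NonCMTwoConverse` at `r = 0` IS the pair of converse items, and states the fully itemised ledger: **U₂|`closes` ⟸ items of THREE routes +
EXP⁺ + EXP⁻ + the off-semistable rank-zero `2`-converse + PRINT**.  Nothing here is progress on BSD.

References: [GrossZagier1986] Thm. I.6.3, V.§2; [BCDTJAMS2001] Thm. A; [MazurRubin2010] Prop. 3.3, Cor. 3.4 (i); [Kramer1981] §2 Props. 3, 6;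
[KrizLi2019] Rem. 1.14; [Miller2011LMS] Def. 1.1.
-/

set_option autoImplicit false
set_option linter.dupNamespace false -- `Summit.<P>.<Sub>` repeats `BirchSwinnertonDyer` (D-0017)

noncomputable section

open scoped Classical

open WeierstrassCurve NumberField Literature.NumberTheory.EllipticCurves
  Literature.NumberTheory.EllipticCurves.ModularForms
  Literature.NumberTheory.EllipticCurves.Rank1Residual
  Summit.BirchSwinnertonDyer.Rank1Residual
  Summit.BirchSwinnertonDyer.Rank1Residual.F1Sign2
  Summit.BirchSwinnertonDyer.BirchSwinnertonDyer.Rank1Residual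
  Summit.BirchSwinnertonDyer.BirchSwinnertonDyer.Theses.GenusKolyvaginAtTwo
  Summit.BirchSwinnertonDyer.BirchSwinnertonDyer.Theorems.GenusExact.TwinSwap

open Summit.BirchSwinnertonDyer.BirchSwinnertonDyer.Theses.TwoAdicConverse
  (GoodOrdinaryRankZeroTwoConverse MultiplicativeRankZeroTwoConverse)
open Summit.BirchSwinnertonDyer.BirchSwinnertonDyer.Theses.ByReductionTypeAtTwo
  (GoodOrdinaryRankZeroAtTwo MultiplicativeRankZeroAtTwo SupersingularRankZeroAtTwo AdditiveRankZeroAtTwo)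

namespace Summit.BirchSwinnertonDyer.BirchSwinnertonDyer.Theorems.GenusExact.TwinSwap.Ledger.Line25

/-! ## §1 The converse ledger (walls as displayed hypotheses) -/

/-- **THE CONVERSE LEDGER ON REV 57/59: U₂|`closes` ⟸ S1⁺ + S1⁻ + (stmt-19218 + stmt-19219 + off-semistable rank-zero `2`-converse) + EXP⁺ +
EXP⁻ + `S_id` + PRINT.**  p773745's NV/EXP ledger `nonCMAtTwo_of_items_of_slicedWall_of_nonvanishing_of_exponent_of_idLocus_line25` with BOTH
L-value supplies NV⁺, NV⁻ DISCHARGED by §3 from the three-piece rank-zero `2`-converse (`rankZeroTwoConverse_of_items_of_offSemistable`: route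
`TwoAdicConverse`'s items `GoodOrdinaryRankZeroTwoConverse` stmt-19218 and `MultiplicativeRankZeroTwoConverse` stmt-19219 BY NAME, plus the
converse off the semistable-ordinary locus at `2`).  DISPLAYED beyond this route's items: the two-cell rank-zero WALL (S1⁺, S1⁻), the rank-zero
`2`-converse (two EXISTING items + one residual shape), the two EXPONENT statements EXP± (the 2-adic exponent of `y_K`; lossless), `S_id`
(stmt-32821), the PRINT facts and the modular parametrisation.  So inside the consumed cells U₂ has NO independent L-value input left: its
analytic supply is the sibling route's rank-zero `2`-converse.  CONDITIONAL on all displayed hypotheses; proves nothing about BSD by itself;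
closes no item.  [cite: GrossZagier1986, Thm. I.6.3, V.§2 (2.2)] [cite: BCDTJAMS2001, Thm. A] [cite: MazurRubin2010, Cor. 3.4 (i), Prop. 3.3]
[cite: Kramer1981, §2 Props. 3, 6] [cite: KrizLi2019, Rem. 1.14] [cite: Miller2011LMS, Def. 1.1] -/
theorem nonCMAtTwo_of_items_of_slicedWall_of_rankZeroTwoConverse_of_exponent_of_idLocus_line25
    (hP : GenusPrimitiveSupplyAtTwoPosDiscShallow) (hPG : GenusDeepSupplyAtTwoNegDiscNarrow) (hQ1 : CyclicTorsionOfNegDisc)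
    (hQ2 : KolyvaginRelationAtTwo)
    (hQ5R : EquivariantChebotarevAtTwoR) (hQ3RT : EquivariantKolyvaginExactAtTwoRT)
    (hQ4T : KolyvaginExactAtTwoPosDiscT) (hGf : ExactDescentAtTwoOfFourFacts)
    (hR : OffHabitatResidualAtTwo) (hOff : OffCutResidualAtTwoR)
    (hK1P : K1Pos) (hK1N : K1Neg) (hSha1 : ShaVanishingAtDepthZeroAtTwo)
    (hS1pos : ∀ (W : WeierstrassCurve ℚ) [W.IsElliptic] [W.IsGloballyMinimal],
      ¬ W.HasCM → W.analyticRank = 0 → Nat.card (W.selmerGroup 2) = 1 → 0 < W.Δ → padicValNat 2 W.tamagawaProduct = 0 → BSDp W 2)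
    (hS1neg : ∀ (W : WeierstrassCurve ℚ) [W.IsElliptic] [W.IsGloballyMinimal],
      ¬ W.HasCM → W.analyticRank = 0 → Nat.card (W.selmerGroup 2) = 1 → W.Δ < 0 → padicValNat 2 W.tamagawaProduct = 2 → BSDp W 2)
    (hC0g : GoodOrdinaryRankZeroTwoConverse) (hC0m : MultiplicativeRankZeroTwoConverse)
    (hC0r : ∀ (V : WeierstrassCurve ℚ) [V.IsElliptic] [V.IsGloballyMinimal], ¬ V.HasCM → ¬ (GoodOrd V 2 ∨ Mult V 2) →
      V.selmerCorank 2 = 0 → V.analyticRank = 0)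
    (hEXPpos : ∀ (W : WeierstrassCurve ℚ) [W.IsElliptic] [W.IsGloballyMinimal] [NeZero (W.conductorNorm ℤ)],
      ¬ W.HasCM → W.analyticRank = 1 → Nat.card (W.selmerGroup 2) = 2 → Odd W.tamagawaProduct → W.HasSurjectiveModNGaloisRep 2 →
      0 < W.Δ → MeetsEgg W →
      ∀ (K : Type) [Field K] [NumberField K], IsImaginaryQuadratic K →
        ∀ (ℓ : ℕ), ℓ.Prime → NumberField.discr K = -(ℓ : ℤ) →
        (∀ x : ZMod ℓ, 4 * x ^ 3 + ((integralModelInt W).b₂ : ZMod ℓ) * x ^ 2 +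
            2 * ((integralModelInt W).b₄ : ZMod ℓ) * x + ((integralModelInt W).b₆ : ZMod ℓ) ≠ 0) →
        Odd (NumberField.discr K) → NumberField.discr K ≠ -3 → SatisfiesHeegnerHypothesis (W.conductorNorm ℤ) K →
        (W.quadraticTwist (NumberField.discr K : ℚ)).entireLFunction 1 ≠ 0 →
        ∀ (Dt : ModularParametrizationData W (W.conductorNorm ℤ)) (β : ℤ) (ι : K →+* ℂ) (d₁ : KolyvaginHeegnerData Dt β ι 1),
          ∃ M₀ : ℕ, padicValInt 2 Dt.c = M₀ ∧
            (∃ Q : (W.baseChange (ringClassField K ι 1)).toAffine.Point, ((2 ^ M₀ : ℕ) : ℤ) • Q = d₁.derivedPoint) ∧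
            (¬ ∃ Q : (W.baseChange (ringClassField K ι 1)).toAffine.Point, ((2 ^ (M₀ + 1) : ℕ) : ℤ) • Q = d₁.derivedPoint))
    (hEXPneg : ∀ (W : WeierstrassCurve ℚ) [W.IsElliptic] [W.IsGloballyMinimal] [NeZero (W.conductorNorm ℤ)],
      ¬ W.HasCM → W.analyticRank = 1 → Nat.card (W.selmerGroup 2) = 2 → W.Δ < 0 → padicValNat 2 W.tamagawaProduct = 1 →
      ∀ (K : Type) [Field K] [NumberField K], IsImaginaryQuadratic K →
        ∀ (ℓ : ℕ) [Fact ℓ.Prime], NumberField.discr K = -(ℓ : ℤ) → ¬ W.selmerGroup 2 ≤ MazurRubin2010.strictLocalKer W ℚ_[ℓ] 2 →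
        Odd (NumberField.discr K) → NumberField.discr K ≠ -3 → SatisfiesHeegnerHypothesis (W.conductorNorm ℤ) K →
        ((Ideal.span {(2 : ℤ)}).primesOver (𝓞 K)).ncard = 2 →
        (W.quadraticTwist (NumberField.discr K : ℚ)).entireLFunction 1 ≠ 0 →
        ∀ (Dt : ModularParametrizationData W (W.conductorNorm ℤ)) (β : ℤ) (ι : K →+* ℂ) (d₁ : KolyvaginHeegnerData Dt β ι 1),
          (∃ Q : (W.baseChange (ringClassField K ι 1)).toAffine.Point,
            ((2 ^ (padicValInt 2 Dt.c + 1) : ℕ) : ℤ) • Q = d₁.derivedPoint) ∧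
          (¬ ∃ Q : (W.baseChange (ringClassField K ι 1)).toAffine.Point,
            ((2 ^ (padicValInt 2 Dt.c + 1 + 1) : ℕ) : ℤ) • Q = d₁.derivedPoint))
    (hSid : ∀ (W : WeierstrassCurve ℚ) [W.IsElliptic] [W.IsGloballyMinimal], ¬ W.HasCM →
      (∀ n : ℕ, W.HasSurjectiveModNGaloisRep ((2 ^ n : ℕ) : ℤ)) → W.analyticRank = 1 →
      (0 < W.Δ ∧ Summit.BirchSwinnertonDyer.Rank1Residual.F1Sign2.NoRationalTwoTorsion W ∧
        Summit.BirchSwinnertonDyer.Rank1Residual.F1Sign2.ShaTwoTrivial W ∧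
        ¬ Summit.BirchSwinnertonDyer.Rank1Residual.F1Sign2.MeetsEgg W ∧ ¬ 2 ∣ W.tamagawaProduct) →
      Literature.NumberTheory.EllipticCurves.BSDp W 2)
    (hMP : nonempty_modularParametrizationData)
    (hL : EntireLFunctionRat)
    (hGZ : GrossZagierAllLevels) (hGZK : MultPublishedInputsAtTwo) (hMi : MilneAnyModel) :
    NonCMAtTwo :=
  nonCMAtTwo_of_items_of_slicedWall_of_nonvanishing_of_exponent_of_idLocus_line25 hP hPG hQ1 hQ2 hQ5R hQ3RT hQ4T hGf hR hOff
    hK1P hK1N hSha1 hS1pos hS1neg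
    (nonvanishingSilent_of_rankZeroTwoConverse_of_facts (rankZeroTwoConverse_of_items_of_offSemistable hC0g hC0m hC0r) hGZK hL)
    hEXPpos
    (nonvanishingDoor_of_rankZeroTwoConverse_of_facts (rankZeroTwoConverse_of_items_of_offSemistable hC0g hC0m hC0r) hGZK hL)
    hEXPneg hSid hMP hL hGZ hGZK hMi

/-! ## §2 The fully itemised ledger: the WALL by name from route `ByReductionTypeAtTwo` -/

/-- **The two sliced walls S1⁺ / S1⁻ ⟸ route `ByReductionTypeAtTwo`'s WALL row 1 BY NAME** — items stmt-BirchSwinnertonDyer-19095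
`GoodOrdinaryRankZeroAtTwo`, stmt-19096 `MultiplicativeRankZeroAtTwo`, stmt-19097 `SupersingularRankZeroAtTwo`, stmt-19098 `AdditiveRankZeroAtTwo`
(rank-`0` `BSD₂` for non-CM curves by reduction type at `2`): the reduction-type tetrachotomy at `2` (LINE 23's P1 door, skeleton
`Cruxes/MinimalTwinBSDTwo/Lines/twin_swap.lean` `minimalRankZeroBSDTwo_of_wall`, here against the landed ledger's slice shape; the Selmer / sign /
Tamagawa clauses of the slices are simply dropped).  [folklore] -/
theorem slicedWalls_of_wallItems (hOrd : GoodOrdinaryRankZeroAtTwo) (hMult : MultiplicativeRankZeroAtTwo)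
    (hSS : SupersingularRankZeroAtTwo) (hAdd : AdditiveRankZeroAtTwo) :
    (∀ (W : WeierstrassCurve ℚ) [W.IsElliptic] [W.IsGloballyMinimal],
      ¬ W.HasCM → W.analyticRank = 0 → Nat.card (W.selmerGroup 2) = 1 → 0 < W.Δ → padicValNat 2 W.tamagawaProduct = 0 → BSDp W 2) ∧
    (∀ (W : WeierstrassCurve ℚ) [W.IsElliptic] [W.IsGloballyMinimal],
      ¬ W.HasCM → W.analyticRank = 0 → Nat.card (W.selmerGroup 2) = 1 → W.Δ < 0 → padicValNat 2 W.tamagawaProduct = 2 → BSDp W 2) := by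
  haveI : Fact (Nat.Prime 2) := ⟨Nat.prime_two⟩
  have wall : ∀ (W : WeierstrassCurve ℚ) [W.IsElliptic] [W.IsGloballyMinimal], ¬ W.HasCM → W.analyticRank = 0 → BSDp W 2 := by
    intro W _ _ hCM hr
    by_cases hg : W.HasGoodReductionAtPrime 2
    · by_cases hd : ((2 : ℕ) : ℤ) ∣ W.frobeniusTrace 2
      · exact hSS W hCM hr ⟨hg, hd⟩
      · exact hOrd W hCM hr ⟨hg, hd⟩
    · by_cases hm : W.HasMultiplicativeReductionAtPrime 2
      · exact hMult W hCM hr hm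
      · exact hAdd W hCM hr ⟨hg, hm⟩
  exact ⟨fun W _ _ hCM hr _ _ _ ↦ wall W hCM hr, fun W _ _ hCM hr _ _ _ ↦ wall W hCM hr⟩

/-- **Rung S3's leaf at `r = 0` gives both rank-zero `2`-converse items**: the registered leaf `Rank1Residual.NonCMTwoConverse` (closed by route
`TwoAdicConverse`'s assembly FROM these items; conjecture-grade) restricted to corank `0` is exactly `GoodOrdinaryRankZeroTwoConverse ∧
MultiplicativeRankZeroTwoConverse` — so U₂'s L-value supplies are priced equally by the LEAF of rung S3.  [folklore] -/
theorem rankZeroTwoConverses_of_nonCMTwoConverse (h : NonCMTwoConverse) :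
    GoodOrdinaryRankZeroTwoConverse ∧ MultiplicativeRankZeroTwoConverse :=
  ⟨fun W _ _ hcm hgo hco ↦ h W hcm (Or.inl hgo) 0 (by norm_num) hco,
   fun W _ _ hcm hm hco ↦ h W hcm (Or.inr hm) 0 (by norm_num) hco⟩

/-- **THE FULLY ITEMISED LEDGER: U₂|`closes` ⟸ ITEMS OF THREE ROUTES + EXP⁺ + EXP⁻ + the off-semistable rank-zero `2`-converse + PRINT.**
§1 with the sliced walls S1⁺ / S1⁻ taken BY NAME from route `ByReductionTypeAtTwo`'s WALL row 1 (stmt-19095 `GoodOrdinaryRankZeroAtTwo`, stmt-19096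
`MultiplicativeRankZeroAtTwo`, stmt-19097 `SupersingularRankZeroAtTwo`, stmt-19098 `AdditiveRankZeroAtTwo`; `slicedWalls_of_wallItems`) and the L-value
supplies from route `TwoAdicConverse`'s stmt-19218 / stmt-19219 (§1).  What is displayed BEYOND the items of the three routes (`GenusKolyvaginAtTwo`'s as in
`closes`, the four wall items, the two converse items, `S_id` = stmt-32821 signature verbatim) and PRINT: ONLY the two EXPONENT statements EXP± (the
2-adic exponent of `y_K` on the two consumed cells — lossless, `= BSD₂` there modulo the rest) and the rank-zero `2`-converse OFF the semistable-ordinary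
locus at `2` (`hC0r`, nobody's item: the rank-`0` analogue of this route's declared residual `RankOneTwoConverseOffSemistableAtTwo`, stmt-24948).
CONDITIONAL on all displayed hypotheses; proves nothing about BSD by itself; closes no item.
[cite: GrossZagier1986, Thm. I.6.3, V.§2 (2.2)] [cite: BCDTJAMS2001, Thm. A] [cite: MazurRubin2010, Cor. 3.4 (i), Prop. 3.3] [cite: Kramer1981, §2 Props. 3, 6]
[cite: KrizLi2019, Rem. 1.14] [cite: Miller2011LMS, Def. 1.1] -/
theorem nonCMAtTwo_of_items_of_wallItems_of_rankZeroTwoConverse_of_exponent_of_idLocus_line25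
    (hP : GenusPrimitiveSupplyAtTwoPosDiscShallow) (hPG : GenusDeepSupplyAtTwoNegDiscNarrow) (hQ1 : CyclicTorsionOfNegDisc)
    (hQ2 : KolyvaginRelationAtTwo)
    (hQ5R : EquivariantChebotarevAtTwoR) (hQ3RT : EquivariantKolyvaginExactAtTwoRT)
    (hQ4T : KolyvaginExactAtTwoPosDiscT) (hGf : ExactDescentAtTwoOfFourFacts)
    (hR : OffHabitatResidualAtTwo) (hOff : OffCutResidualAtTwoR)
    (hK1P : K1Pos) (hK1N : K1Neg) (hSha1 : ShaVanishingAtDepthZeroAtTwo)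
    (hOrd : GoodOrdinaryRankZeroAtTwo) (hMult : MultiplicativeRankZeroAtTwo)
    (hSS : SupersingularRankZeroAtTwo) (hAdd : AdditiveRankZeroAtTwo)
    (hC0g : GoodOrdinaryRankZeroTwoConverse) (hC0m : MultiplicativeRankZeroTwoConverse)
    (hC0r : ∀ (V : WeierstrassCurve ℚ) [V.IsElliptic] [V.IsGloballyMinimal], ¬ V.HasCM → ¬ (GoodOrd V 2 ∨ Mult V 2) →
      V.selmerCorank 2 = 0 → V.analyticRank = 0)
    (hEXPpos : ∀ (W : WeierstrassCurve ℚ) [W.IsElliptic] [W.IsGloballyMinimal] [NeZero (W.conductorNorm ℤ)],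
      ¬ W.HasCM → W.analyticRank = 1 → Nat.card (W.selmerGroup 2) = 2 → Odd W.tamagawaProduct → W.HasSurjectiveModNGaloisRep 2 →
      0 < W.Δ → MeetsEgg W →
      ∀ (K : Type) [Field K] [NumberField K], IsImaginaryQuadratic K →
        ∀ (ℓ : ℕ), ℓ.Prime → NumberField.discr K = -(ℓ : ℤ) →
        (∀ x : ZMod ℓ, 4 * x ^ 3 + ((integralModelInt W).b₂ : ZMod ℓ) * x ^ 2 +
            2 * ((integralModelInt W).b₄ : ZMod ℓ) * x + ((integralModelInt W).b₆ : ZMod ℓ) ≠ 0) →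
        Odd (NumberField.discr K) → NumberField.discr K ≠ -3 → SatisfiesHeegnerHypothesis (W.conductorNorm ℤ) K →
        (W.quadraticTwist (NumberField.discr K : ℚ)).entireLFunction 1 ≠ 0 →
        ∀ (Dt : ModularParametrizationData W (W.conductorNorm ℤ)) (β : ℤ) (ι : K →+* ℂ) (d₁ : KolyvaginHeegnerData Dt β ι 1),
          ∃ M₀ : ℕ, padicValInt 2 Dt.c = M₀ ∧
            (∃ Q : (W.baseChange (ringClassField K ι 1)).toAffine.Point, ((2 ^ M₀ : ℕ) : ℤ) • Q = d₁.derivedPoint) ∧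
            (¬ ∃ Q : (W.baseChange (ringClassField K ι 1)).toAffine.Point, ((2 ^ (M₀ + 1) : ℕ) : ℤ) • Q = d₁.derivedPoint))
    (hEXPneg : ∀ (W : WeierstrassCurve ℚ) [W.IsElliptic] [W.IsGloballyMinimal] [NeZero (W.conductorNorm ℤ)],
      ¬ W.HasCM → W.analyticRank = 1 → Nat.card (W.selmerGroup 2) = 2 → W.Δ < 0 → padicValNat 2 W.tamagawaProduct = 1 →
      ∀ (K : Type) [Field K] [NumberField K], IsImaginaryQuadratic K →
        ∀ (ℓ : ℕ) [Fact ℓ.Prime], NumberField.discr K = -(ℓ : ℤ) → ¬ W.selmerGroup 2 ≤ MazurRubin2010.strictLocalKer W ℚ_[ℓ] 2 →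
        Odd (NumberField.discr K) → NumberField.discr K ≠ -3 → SatisfiesHeegnerHypothesis (W.conductorNorm ℤ) K →
        ((Ideal.span {(2 : ℤ)}).primesOver (𝓞 K)).ncard = 2 →
        (W.quadraticTwist (NumberField.discr K : ℚ)).entireLFunction 1 ≠ 0 →
        ∀ (Dt : ModularParametrizationData W (W.conductorNorm ℤ)) (β : ℤ) (ι : K →+* ℂ) (d₁ : KolyvaginHeegnerData Dt β ι 1),
          (∃ Q : (W.baseChange (ringClassField K ι 1)).toAffine.Point,
            ((2 ^ (padicValInt 2 Dt.c + 1) : ℕ) : ℤ) • Q = d₁.derivedPoint) ∧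
          (¬ ∃ Q : (W.baseChange (ringClassField K ι 1)).toAffine.Point,
            ((2 ^ (padicValInt 2 Dt.c + 1 + 1) : ℕ) : ℤ) • Q = d₁.derivedPoint))
    (hSid : ∀ (W : WeierstrassCurve ℚ) [W.IsElliptic] [W.IsGloballyMinimal], ¬ W.HasCM →
      (∀ n : ℕ, W.HasSurjectiveModNGaloisRep ((2 ^ n : ℕ) : ℤ)) → W.analyticRank = 1 →
      (0 < W.Δ ∧ Summit.BirchSwinnertonDyer.Rank1Residual.F1Sign2.NoRationalTwoTorsion W ∧
        Summit.BirchSwinnertonDyer.Rank1Residual.F1Sign2.ShaTwoTrivial W ∧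
        ¬ Summit.BirchSwinnertonDyer.Rank1Residual.F1Sign2.MeetsEgg W ∧ ¬ 2 ∣ W.tamagawaProduct) →
      Literature.NumberTheory.EllipticCurves.BSDp W 2)
    (hMP : nonempty_modularParametrizationData)
    (hL : EntireLFunctionRat)
    (hGZ : GrossZagierAllLevels) (hGZK : MultPublishedInputsAtTwo) (hMi : MilneAnyModel) :
    NonCMAtTwo :=
  nonCMAtTwo_of_items_of_slicedWall_of_rankZeroTwoConverse_of_exponent_of_idLocus_line25 hP hPG hQ1 hQ2 hQ5R hQ3RT hQ4T hGf hR hOff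
    hK1P hK1N hSha1 (slicedWalls_of_wallItems hOrd hMult hSS hAdd).1 (slicedWalls_of_wallItems hOrd hMult hSS hAdd).2
    hC0g hC0m hC0r hEXPpos hEXPneg hSid hMP hL hGZ hGZK hMi

end Summit.BirchSwinnertonDyer.BirchSwinnertonDyer.Theorems.GenusExact.TwinSwap.Ledger.Line25

end
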